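import Mathlib
import Summits.NavierStokesRegularity.NavierStokesRegularity.Theorems.TaoLadderRungTwoBreakOneShiftWindowGridD
import HarnessLib

/-!
# The one-shift window system, XL: THE FLOW SLOPE OF THE GRID FROM DYADIC DATA — with all per-step, link, initial and
# product tests of a `GridD` passed, any two runs of the same rough realisation from `a, b` in the first start box
# have ONE real matrix `U` with entries in `V_{S+1}` and `S_u(τ) − S_v(τ) = U (a − b)` for every `τ` of the final step
# (part XX `exists_gridSlope`; per-step slopes by parts XXXVI/XXXVIII; start boxes by part XXXIX) — the `hU` input of
# part XIII / the `V` of part XI's residual slope (cell harvest/h2-tao-ladder, seat p2; rung1/KERNEL-CHEAP-REPLAY-SPEC.md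
# §2 (g)/(h), §7 (R4), §8; support for K1(1) = `NoSurvivingDSSOne`, stmt-NavierStokesRegularity-20205)

MODEL lattice ODEs only (Tao 2016 §4 normal form on Tao's shift set `S`); nothing here is a statement about
the Navier–Stokes equations; no item is closed; no instance is evaluated here. Generic in `ι`, `κ`.
-/

-- the sub-problem namespace repeats the summit name by design (D-0017)
set_option linter.dupNamespace false

namespace Summit.NavierStokesRegularity.NavierStokesRegularity.Theorems

namespace DSSOneShift

open Set Finset Metric Filter Topology TopologicalSpace
open Literature.Analysis.ODE
open Summit.NavierStokesRegularity.NavierStokesRegularity.Theorems.TaylorModelCert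
open Summit.NavierStokesRegularity.NavierStokesRegularity.Theorems.TaylorModelReadout
open Summit.NavierStokesRegularity.NavierStokesRegularity.Theorems.CertificateGlueOn

namespace GridD

variable (g : GridD) {ι : Type*} [Fintype ι] [DecidableEq ι] {κ : Type*} [Fintype κ]

omit [Fintype ι] [DecidableEq ι] in
/-- The real bounds of `A_s` read through `e` are those of the pair step. [folklore] -/
theorem Aent_toReal (e : ι ≃ Fin g.n) (hn : ∀ s, (g.step s).n = g.n) (s : ℕ) (i l : ι) :
    (g.Aent s (e i) (e l)).lo.toReal =
      ((g.step s).toRoughStepD.centre.vv (g.es e hn s i) (g.es e hn s l)).lo.toReal - (g.step s).cZh (g.es e hn s) i l ∧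
    (g.Aent s (e i) (e l)).hi.toReal =
      ((g.step s).toRoughStepD.centre.vv (g.es e hn s i) (g.es e hn s l)).hi.toReal + (g.step s).cZh (g.es e hn s) i l := by
  simp [Aent, PairStepD.cZh, es_val, Dyad.toReal_sub, Dyad.toReal_add]

omit [DecidableEq ι] in
/-- A step of the product chain: real matrices in `A_s` and `V_s` multiply into `V_{s+1}`. [cite: Neumaier1991, §3.1 Proposition 3.1.2 (6)–(7)] -/
theorem mem_Vent_succ (e : ι ≃ Fin g.n) {s : ℕ} (hp : g.prodOK s = true) {M P : Matrix ι ι ℝ}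
    (hM : ∀ i j, (g.Aent s (e i) (e j)).lo.toReal ≤ M i j ∧ M i j ≤ (g.Aent s (e i) (e j)).hi.toReal)
    (hP : ∀ i l, IntervalD.mem (P i l) (g.Vent s (e i) (e l))) :
    ∀ i l, IntervalD.mem ((M * P) i l) (g.Vent (s + 1) (e i) (e l)) := by
  intro i l
  refine IntervalD.mem_of_subset (g.of_prodOK hp (e i) (e i).isLt (e l) (e l).isLt) ?_
  rw [Matrix.mul_apply]
  unfold prodEnt
  refine mem_sum_equiv e g.prec fun k hk => ?_
  have h1 := hM i (e.symm ⟨k, hk⟩)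
  have h2 := hP (e.symm ⟨k, hk⟩) l
  simp only [Equiv.apply_symm_apply] at h1 h2
  exact IntervalD.mem_mulR g.prec ⟨h1.1, h1.2⟩ h2

omit [Fintype ι] in
/-- The identity lies in `V_0`. [folklore] -/
theorem mem_Vent_zero (e : ι ≃ Fin g.n) (h0 : g.initOK = true) :
    ∀ i l, IntervalD.mem ((1 : Matrix ι ι ℝ) i l) (g.Vent 0 (e i) (e l)) := by
  intro i l
  refine IntervalD.mem_of_subset (g.of_initOK h0 (e i) (e i).isLt (e l) (e l).isLt) ?_
  rw [Matrix.one_apply]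
  by_cases h : i = l
  · subst h; simp only [if_true]; exact_mod_cast IntervalD.mem_ofInt 1
  · rw [if_neg h, if_neg (fun h' => h (e.injective (Fin.ext h')))]; exact_mod_cast IntervalD.mem_ofInt 0

/-- **THE FLOW SLOPE OF THE GRID.** [cite: Tao2016AveragedNS, §5.3; WalawskaWilczak2016, §2.2 Lemma 2; cell vocabulary, harvest/h2-tao-ladder rung1/KERNEL-CHEAP-REPLAY-SPEC.md §2 (g)/(h)] -/
theorem exists_flowSlope_of_grid (e : ι ≃ Fin g.n) (hn : ∀ s, (g.step s).n = g.n)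
    {Tc : ℕ → κ → BTerm ι} {Tf : ℝ → κ → BTerm ι} {rows : ι → List κ}
    (hRDc : ∀ s ≤ g.S, IsRTEncl (g.es e hn s) (Tc s) (Tc s) rows (g.step s).RD)
    (hRD : ∀ s ≤ g.S, ∀ r ∈ Ico 0 (g.h s).toReal, IsRTEncl (g.es e hn s) (Tc s) (Tf (g.t s + r)) rows (g.step s).RD)
    (hstep : ∀ s ≤ g.S, g.stepOK s = true) (hlink : ∀ s < g.S, g.linkOK s = true) (hinit : g.initOK = true)
    (hprod : ∀ s ≤ g.S, g.prodOK s = true)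
    {T : ℝ} (hT : g.t g.S + (g.h g.S).toReal ≤ T) {a b : ι → ℝ} (ha : a ∈ boxSet (boxOf e (g.step 0).W))
    (hb : b ∈ boxSet (boxOf e (g.step 0).W)) {Su Sv : ℝ → ι → ℝ} (hSu0 : Su 0 = a) (hSv0 : Sv 0 = b)
    (hSu : ∀ t ∈ Icc 0 T, HasDerivWithinAt Su (termField (Tf t) (Su t)) (Icc 0 T) t)
    (hSv : ∀ t ∈ Icc 0 T, HasDerivWithinAt Sv (termField (Tf t) (Sv t)) (Icc 0 T) t)
    {τ : ℝ} (hτ : τ ∈ Icc (g.t g.S) (g.t g.S + (g.h g.S).toReal)) :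
    ∃ U : Matrix ι ι ℝ, (∀ i l, (g.Vent (g.S + 1) (e i) (e l)).lo.toReal ≤ U i l ∧ U i l ≤ (g.Vent (g.S + 1) (e i) (e l)).hi.toReal) ∧
      Su τ - Sv τ = U.mulVec (a - b) := by
  classical
  have hchk : ∀ s ≤ g.S, (g.step s).check = true := fun s hs => by
    have := hstep s hs
    simp only [stepOK, Bool.and_eq_true, decide_eq_true_eq] at this
    exact this.1
  have hh : ∀ s, s ≤ g.S → 0 ≤ (g.h s).toReal := fun s hs => by
    have hc' : (g.step s).toRoughStepD.check = true ∧ (g.step s).checkPair = true := by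
      simpa [PairStepD.check, Bool.and_eq_true] using hchk s hs
    have hrc' : (g.step s).toRoughStepD.centre.check = true ∧ (g.step s).toRoughStepD.checkKZ = true := by
      simpa [RoughStepD.check, Bool.and_eq_true] using hc'.1
    exact ((g.step s).toRoughStepD.centre.of_checkWith (by rw [← CentreStepD.check_eq]; exact hrc'.1)).2.1
  -- start boxes along the grid
  have hWu := g.mem_start_of_grid e hn hRDc hRD hstep hlink hT ha hSu0 hSu
  have hWv := g.mem_start_of_grid e hn hRDc hRD hstep hlink hT hb hSv0 hSv
  -- grid times
  have ht0 : ∀ s ≤ g.S, 0 ≤ g.t s := fun s hs => g.t_nonneg fun k hk => hh k (by omega)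
  have htT : ∀ s ≤ g.S, g.t s + (g.h s).toReal ≤ T := fun s hs => (g.t_add_le hs fun k hk => hh k hk).trans hT
  -- the re-clocked runs on a step
  have hrunU : ∀ s ≤ g.S, ∀ r ∈ Icc 0 (g.h s).toReal,
      HasDerivWithinAt (fun r => Su (g.t s + r)) (termField (Tf (g.t s + r)) (Su (g.t s + r))) (Icc 0 (g.h s).toReal) r :=
    fun s hs r hr => hasDerivWithinAt_shift (S := Su) (S' := fun t => termField (Tf t) (Su t)) hSu (ht0 s hs) (htT s hs) hr
  have hrunV : ∀ s ≤ g.S, ∀ r ∈ Icc 0 (g.h s).toReal,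
      HasDerivWithinAt (fun r => Sv (g.t s + r)) (termField (Tf (g.t s + r)) (Sv (g.t s + r))) (Icc 0 (g.h s).toReal) r :=
    fun s hs r hr => hasDerivWithinAt_shift (S := Sv) (S' := fun t => termField (Tf t) (Sv t)) hSv (ht0 s hs) (htT s hs) hr
  -- real boxes of the step slopes and of the products
  let lo : ℕ → Matrix ι ι ℝ := fun s => Matrix.of fun i j => (g.Aent s (e i) (e j)).lo.toReal
  let hi : ℕ → Matrix ι ι ℝ := fun s => Matrix.of fun i j => (g.Aent s (e i) (e j)).hi.toReal
  let Ulo : Matrix ι ι ℝ := Matrix.of fun i j => (g.Vent (g.S + 1) (e i) (e j)).lo.toReal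
  let Uhi : Matrix ι ι ℝ := Matrix.of fun i j => (g.Vent (g.S + 1) (e i) (e j)).hi.toReal
  -- per-step slopes
  have hslope : ∀ s ≤ g.S, ∀ τ' ∈ Icc 0 (g.h s).toReal, ∃ U : Matrix ι ι ℝ,
      (∀ i j, lo s i j ≤ U i j ∧ U i j ≤ hi s i j) ∧ Su (g.t s + τ') - Sv (g.t s + τ') = U.mulVec (Su (g.t s) - Sv (g.t s)) := by
    intro s hs τ' hτ'
    have hau : Su (g.t s) ∈ boxSet (boxOf (g.es e hn s) (g.step s).W) := by rw [boxOf_es]; exact hWu s hs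
    have hbv : Sv (g.t s) ∈ boxSet (boxOf (g.es e hn s) (g.step s).W) := by rw [boxOf_es]; exact hWv s hs
    obtain ⟨U, hU, hrep⟩ := (g.step s).sound_at (g.es e hn s) (hRDc s hs) (hRD s hs) (hchk s hs) hau hbv
      (Su := fun r => Su (g.t s + r)) (Sv := fun r => Sv (g.t s + r)) (by simp) (by simp) (hrunU s hs) (hrunV s hs) hτ'
    refine ⟨U, fun i j => ?_, hrep⟩
    have h1 := hU i j
    have h2 := g.Aent_toReal e hn s i j
    simp only [lo, hi, Matrix.of_apply]
    rw [h2.1, h2.2]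
    exact h1
  -- part XX
  refine exists_gridSlope Su Sv g.t g.t_zero g.S τ lo hi (lo g.S) (hi g.S) Ulo Uhi ?_ ?_ ?_ |>.imp fun U hU => ?_
  · intro s hs
    obtain ⟨U, hU, hrep⟩ := hslope s hs.le (g.h s).toReal ⟨hh s hs.le, le_rfl⟩
    exact ⟨U, hU, by rw [t_succ]; exact hrep⟩
  · have hτ' : τ - g.t g.S ∈ Icc 0 (g.h g.S).toReal := ⟨by linarith [hτ.1], by linarith [hτ.2]⟩
    obtain ⟨U, hU, hrep⟩ := hslope g.S le_rfl (τ - g.t g.S) hτ'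
    refine ⟨U, hU, ?_⟩
    simpa using hrep
  · -- the product enclosure
    intro Us UB hUs hUB
    have hP : ∀ k ≤ g.S, ∀ i l, IntervalD.mem ((((List.range k).map Us).reverse.prod) i l) (g.Vent k (e i) (e l)) := by
      intro k hk
      induction k with
      | zero => simpa using g.mem_Vent_zero e hinit
      | succ k ih =>
        have e1 : ((List.range (k + 1)).map Us).reverse.prod = Us k * ((List.range k).map Us).reverse.prod := by
          rw [List.range_succ, List.map_append, List.reverse_append, List.prod_append]; simp
        rw [e1]
        exact g.mem_Vent_succ e (hprod k (by omega)) (fun i j => by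
          have := hUs k (by omega) i j; simp only [lo, hi, Matrix.of_apply] at this; exact this) (ih (by omega))
    have hfin := g.mem_Vent_succ e (hprod g.S le_rfl) (M := UB) (fun i j => by
      have := hUB i j; simp only [lo, hi, Matrix.of_apply] at this; exact this) (hP g.S le_rfl)
    intro i j
    simp only [Ulo, Uhi, Matrix.of_apply]
    exact ⟨(hfin i j).1, (hfin i j).2⟩
  · obtain ⟨hU1, hU2⟩ := hU
    refine ⟨fun i l => ?_, by rw [hU2, hSu0, hSv0]⟩
    have := hU1 i l
    simp only [Ulo, Uhi, Matrix.of_apply] at this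
    exact this

end GridD

end DSSOneShift

end Summit.NavierStokesRegularity.NavierStokesRegularity.Theorems
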